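import Literature.NumberTheory.Automorphic.AdeleGaloisDescent
import HarnessLib

/-!
# Ideles in a tower `K ⊆ K' ⊆ L`: base change is transitive, the Galois action twists the base
# change by `τ|_{K'}`, and the idelic norm is transitive (`N_{L/K} = N_{K'/K} ∘ N_{L/K'}`)

Topic `NumberTheory/Automorphic` (adeles and ideles); namespace `Literature.NumberTheory.Automorphic`.
Proof file (theorems only: no definition, no named fact, no instance; D-0026), continuing
`AdeleBaseChange` (`AdeleRing.baseChange F E : 𝔸_F → 𝔸_E`, componentwise `F_v → E_w`),
`GaloisActionAdeleRing` (`Aut(E/F)` acting on `𝔸_E`) and `AdeleGaloisDescent`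
(`AdeleRing.ideleRelNorm F E : 𝕀_E → 𝕀_F`, the idelic norm of a finite Galois `E/F`, characterised
by `(N_{E/F} y)_E = ∏_{σ ∈ Gal(E/F)} σ • y`).

For a tower of number fields `K ⊆ K' ⊆ L` (`IsScalarTower`), with `K'|K` normal where an
automorphism `τ ∈ Aut_K(L)` is restricted to `σ = τ|_{K'} ∈ Aut_K(K')`:

* `AdeleRing.baseChange_baseChange` — **transitivity of base change**: `(x_{K'})_L = x_L`;
* `AdeleRing.smul_baseChange_tower` — **`τ • z_L = (τ|_{K'} • z)_L`** for `z ∈ 𝔸_{K'}` (the case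
  `K = K'` is `AdeleRing.smul_baseChange`: `Aut(E/F)` fixes `𝔸_F`);
* `AdeleRing.ideleRelNorm_ideleRelNorm` — **transitivity of the idelic norm**
  `N_{K'/K}(N_{L/K'} y) = N_{L/K} y` for `K'|K`, `L|K'`, `L|K` Galois
  (Cassels–Fröhlich II §11 / VII §2: the norm is transitive in towers, being the determinant of
  multiplication, resp. `∏_τ τ = ∏_σ τ_σ ∏_{a ∈ G(L|K')} a` over coset representatives).

The local ingredients are the uniqueness of continuous extensions to completions
(`HeightOneSpectrum.adicCompletion.ext_of_coe`, `InfinitePlace.Completion.ext_of_coe`): the two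
continuous maps `K'_{w} → L_W` in question agree on the dense image of `K'`.

## References

* J. W. S. Cassels, A. Fröhlich (eds.), *Algebraic Number Theory*, Academic Press 1967, Ch. II
  (Cassels) §11 "Normic ... transitivity", Ch. VII (Tate) §1.1–§2 (`σ_w : L_w → L_{σw}`, the norm on
  ideles), §12 ("`N_{M/K} C_M ⊂ H` is clear, since `N` is transitive"). [CasselsFrohlichANT1967]
-/

noncomputable section

open scoped NumberField Pointwise
open NumberField IsDedekindDomain NumberField.InfinitePlace

namespace Literature.NumberTheory.Automorphic

variable (K K' L : Type) [Field K] [Field K'] [Field L] [NumberField K] [NumberField K'] [NumberField L]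
  [Algebra K K'] [Algebra K' L] [Algebra K L] [IsScalarTower K K' L]

/-! ### Places in the tower -/

omit [NumberField K] [NumberField K'] [NumberField L] in
/-- `(W ∩ 𝓞 K') ∩ 𝓞 K = W ∩ 𝓞 K` for a finite place `W` of `L`. [folklore] -/
theorem HeightOneSpectrum.under_under (W : HeightOneSpectrum (𝓞 L)) :
    (W.under (𝓞 K')).under (𝓞 K) = W.under (𝓞 K) :=
  HeightOneSpectrum.ext (Ideal.under_under (A := 𝓞 K) (B := 𝓞 K') W.asIdeal)

omit [NumberField K] [NumberField K'] [NumberField L] in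
/-- `(W|_{K'})|_K = W|_K` for an infinite place `W` of `L`. [folklore] -/
theorem InfinitePlace.comap_comap_tower (W : InfinitePlace L) :
    (W.comap (algebraMap K' L)).comap (algebraMap K K') = W.comap (algebraMap K L) := by
  rw [← InfinitePlace.comap_comp, ← IsScalarTower.algebraMap_eq]

variable {K K' L}

section Normal

variable [Normal K K']

omit [NumberField K] [NumberField K'] [NumberField L] in
/-- `τ ∈ Aut_K(L)` acts on `𝓞 K' ⊆ 𝓞 L` through `τ|_{K'}`. [folklore] -/
theorem tower_smul_algebraMap (τ : L ≃ₐ[K] L) (x : 𝓞 K') :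
    τ • (algebraMap (𝓞 K') (𝓞 L) x) = algebraMap (𝓞 K') (𝓞 L) (τ.restrictNormal K' • x) := by
  apply RingOfIntegers.ext
  change τ (algebraMap K' L (x : K')) = algebraMap K' L ((τ.restrictNormal K') (x : K'))
  exact (AlgEquiv.restrictNormal_commutes (χ := τ) (E := K') (x : K')).symm

omit [NumberField K] [NumberField K'] [NumberField L] in
/-- `(τ⁻¹)|_{K'} = (τ|_{K'})⁻¹`. [folklore] -/
theorem restrictNormal_inv_tower (τ : L ≃ₐ[K] L) : τ⁻¹.restrictNormal K' = (τ.restrictNormal K')⁻¹ :=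
  map_inv (AlgEquiv.restrictNormalHom K' : (L ≃ₐ[K] L) →* (K' ≃ₐ[K] K')) τ

omit [NumberField K] [NumberField K'] [NumberField L] in
/-- **Places below conjugate places**: `(τ W) ∩ 𝓞 K' = τ|_{K'} (W ∩ 𝓞 K')`.
[cite: CasselsFrohlichANT1967, Ch. VII §1.1] -/
theorem HeightOneSpectrum.under_tower_smul (τ : L ≃ₐ[K] L) (W : HeightOneSpectrum (𝓞 L)) :
    (τ • W).under (𝓞 K') = τ.restrictNormal K' • W.under (𝓞 K') := by
  ext x
  simp only [HeightOneSpectrum.under_asIdeal, HeightOneSpectrum.smul_asIdeal,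
    Ideal.mem_pointwise_smul_iff_inv_smul_mem, Ideal.under_def, Ideal.mem_comap]
  rw [tower_smul_algebraMap, restrictNormal_inv_tower]

omit [NumberField K] [NumberField K'] [NumberField L] in
/-- **Infinite places below conjugate places**: `(τ W)|_{K'} = τ|_{K'} (W|_{K'})`. [folklore] -/
theorem InfinitePlace.comap_tower_smul (τ : L ≃ₐ[K] L) (W : InfinitePlace L) :
    (τ • W).comap (algebraMap K' L) = τ.restrictNormal K' • W.comap (algebraMap K' L) := by
  rw [InfinitePlace.comap_smul]
  change _ = (W.comap (algebraMap K' L)).comap ((τ.restrictNormal K').symm : K' →+* K')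
  rw [← InfinitePlace.comap_comp]
  congr 1
  refine RingHom.ext fun c => ?_
  change τ.symm (algebraMap K' L c) = algebraMap K' L ((τ.restrictNormal K').symm c)
  apply τ.injective
  rw [AlgEquiv.apply_symm_apply, ← AlgEquiv.restrictNormal_commutes (χ := τ) (E := K'),
    AlgEquiv.apply_symm_apply]

end Normal

/-! ### Local maps: transitivity and the twisted equivariance -/

/-- **`K_v → K'_w → L_W` is `K_v → L_W`** (`v = W ∩ K`, `w = W ∩ K'`): both are continuous and
extend `K → L`. [folklore] -/
theorem adicCompletionOfUnder_comp_tower (W : HeightOneSpectrum (𝓞 L))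
    [i : W.asIdeal.LiesOver ((W.under (𝓞 K')).under (𝓞 K)).asIdeal] :
    (adicCompletionOfUnder (𝓞 K') K' L W) ∘ (adicCompletionOfUnder (𝓞 K) K K' (W.under (𝓞 K'))) =
      adicCompletionOfLiesOver K L ((W.under (𝓞 K')).under (𝓞 K)) W := by
  refine HeightOneSpectrum.adicCompletion.ext_of_coe K _
    ((continuous_adicCompletionOfUnder K' L W).comp (continuous_adicCompletionOfUnder K K' _))
    (continuous_adicCompletionOfLiesOver K L _ W) fun c => ?_
  simp only [Function.comp_apply, adicCompletionOfUnder_coe, adicCompletionOfLiesOver_coe,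
    ← IsScalarTower.algebraMap_apply]

omit [NumberField K] [NumberField K'] [NumberField L] in
/-- The archimedean analogue: `K_v → K'_w → L_W` is `K_v → L_W`. [folklore] -/
theorem infiniteCompletionOfComap_comp_tower (W : InfinitePlace L)
    [i : W.1.LiesOver ((W.comap (algebraMap K' L)).comap (algebraMap K K')).1] :
    (infiniteCompletionOfComap K' L W) ∘ (infiniteCompletionOfComap K K' (W.comap (algebraMap K' L))) =
      NumberField.LiesOver.completionMap
        (v := (W.comap (algebraMap K' L)).comap (algebraMap K K')) (w := W) := by
  refine InfinitePlace.Completion.ext_of_coe _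
    ((continuous_infiniteCompletionOfComap K' L W).comp (continuous_infiniteCompletionOfComap K K' _))
    NumberField.LiesOver.continuous_completionMap fun c => ?_
  simp only [Function.comp_apply, infiniteCompletionOfComap_coe, ← IsScalarTower.algebraMap_apply]
  rw [NumberField.LiesOver.completionMap_coe]
  rfl

section Twist

variable [Normal K K']

omit [NumberField K] in
/-- **`τ_W ∘ (K'_{w₀} → L_{τ⁻¹ W}) = (K'_{σ w₀} → L_W) ∘ σ_{w₀}`** for `w₀ = τ⁻¹ W ∩ K'`, `σ = τ|_{K'}`
(both continuous, both extend `c ↦ τ c = σ c` on `K'`). [cite: CasselsFrohlichANT1967, Ch. VII §1.1] -/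
theorem galAdicCompletionMap_comp_adicCompletionOfUnder_tower (τ : L ≃ₐ[K] L)
    (W : HeightOneSpectrum (𝓞 L))
    (h : τ.restrictNormal K' • (τ⁻¹ • W).under (𝓞 K') = W.under (𝓞 K')) :
    (galAdicCompletionMap τ (smul_inv_smul τ W)) ∘ (adicCompletionOfUnder (𝓞 K') K' L (τ⁻¹ • W)) =
      (adicCompletionOfUnder (𝓞 K') K' L W) ∘ (galAdicCompletionMap (τ.restrictNormal K') h) := by
  refine HeightOneSpectrum.adicCompletion.ext_of_coe K' _
    ((continuous_galAdicCompletionMap L τ _).comp (continuous_adicCompletionOfUnder K' L _))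
    ((continuous_adicCompletionOfUnder K' L W).comp (continuous_galAdicCompletionMap K' _ h))
    fun c => ?_
  simp only [Function.comp_apply, adicCompletionOfUnder_coe, galAdicCompletionMap_coe_algEquiv,
    ← AlgEquiv.restrictNormal_commutes (χ := τ) (E := K')]

omit [NumberField K] [NumberField K'] [NumberField L] in
/-- The archimedean analogue of `galAdicCompletionMap_comp_adicCompletionOfUnder_tower`. [folklore] -/
theorem galInfiniteCompletionMap_comp_infiniteCompletionOfComap_tower (τ : L ≃ₐ[K] L)
    (W : InfinitePlace L)
    (h : τ.restrictNormal K' • (τ⁻¹ • W).comap (algebraMap K' L) = W.comap (algebraMap K' L)) :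
    (galInfiniteCompletionMap τ (smul_inv_smul τ W)) ∘ (infiniteCompletionOfComap K' L (τ⁻¹ • W)) =
      (infiniteCompletionOfComap K' L W) ∘ (galInfiniteCompletionMap (τ.restrictNormal K') h) := by
  refine InfinitePlace.Completion.ext_of_coe _
    ((continuous_galInfiniteCompletionMap K τ _).comp (continuous_infiniteCompletionOfComap K' L _))
    ((continuous_infiniteCompletionOfComap K' L W).comp (continuous_galInfiniteCompletionMap K _ h))
    fun c => ?_
  simp only [Function.comp_apply, infiniteCompletionOfComap_coe, galInfiniteCompletionMap_coe,
    ← AlgEquiv.restrictNormal_commutes (χ := τ) (E := K')]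

/-! ### Global statements -/

omit [NumberField K] in
/-- **The Galois action twists the base change: `τ • z_L = (τ|_{K'} • z)_L`** for `z ∈ 𝔸_{K'}` and
`τ ∈ Aut_K(L)`. [cite: CasselsFrohlichANT1967, Ch. VII §1.1] -/
theorem AdeleRing.smul_baseChange_tower (τ : L ≃ₐ[K] L) (z : AdeleRing (𝓞 K') K') :
    τ • AdeleRing.baseChange K' L z = AdeleRing.baseChange K' L (τ.restrictNormal K' • z) := by
  set σ := τ.restrictNormal K' with hσ
  refine Prod.ext (funext fun W => ?_) (FiniteAdeleRing.ext L fun W => ?_)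
  · -- infinite places
    rw [AdeleRing.smul_fst, AdeleRing.baseChange_fst, AdeleRing.baseChange_fst, InfiniteAdeleRing.smul_apply,
      InfiniteAdeleRing.baseChange_apply, InfiniteAdeleRing.baseChange_apply, AdeleRing.smul_fst,
      InfiniteAdeleRing.smul_apply]
    have hw : (τ⁻¹ • W).comap (algebraMap K' L) = σ⁻¹ • W.comap (algebraMap K' L) := by
      rw [InfinitePlace.comap_tower_smul, restrictNormal_inv_tower]
    have h₀ : σ • (τ⁻¹ • W).comap (algebraMap K' L) = W.comap (algebraMap K' L) := by
      rw [hw, smul_inv_smul]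
    rw [← galInfiniteCompletionMap_apply_congr_place (F := K) hw h₀ (smul_inv_smul σ _) z.1]
    exact congrFun (galInfiniteCompletionMap_comp_infiniteCompletionOfComap_tower τ W h₀) _
  · -- finite places
    rw [AdeleRing.smul_snd, AdeleRing.baseChange_snd, AdeleRing.baseChange_snd, FiniteAdeleRing.smul_apply,
      FiniteAdeleRing.baseChange_apply, FiniteAdeleRing.baseChange_apply, AdeleRing.smul_snd,
      FiniteAdeleRing.smul_apply]
    have hw : (τ⁻¹ • W).under (𝓞 K') = σ⁻¹ • W.under (𝓞 K') := by
      rw [HeightOneSpectrum.under_tower_smul, restrictNormal_inv_tower]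
    have h₀ : σ • (τ⁻¹ • W).under (𝓞 K') = W.under (𝓞 K') := by
      rw [hw, smul_inv_smul]
    rw [← galAdicCompletionMap_apply_congr_place (L := K') hw h₀ (smul_inv_smul σ _) z.2]
    exact congrFun (galAdicCompletionMap_comp_adicCompletionOfUnder_tower τ W h₀) _

omit [NumberField K] in
/-- Idelic form: `τ • z_L = (τ|_{K'} • z)_L` for `z ∈ 𝕀_{K'}`. [cite: CasselsFrohlichANT1967, Ch. VII §1.1] -/
theorem AdeleRing.smul_ideleBaseChange_tower (τ : L ≃ₐ[K] L) (z : (AdeleRing (𝓞 K') K')ˣ) :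
    τ • AdeleRing.ideleBaseChange K' L z = AdeleRing.ideleBaseChange K' L (τ.restrictNormal K' • z) :=
  Units.ext (AdeleRing.smul_baseChange_tower τ (z : AdeleRing (𝓞 K') K'))

end Twist

variable (K K' L) in
/-- **Transitivity of base change: `(x_{K'})_L = x_L`.** [folklore] -/
theorem AdeleRing.baseChange_baseChange (x : AdeleRing (𝓞 K) K) :
    AdeleRing.baseChange K' L (AdeleRing.baseChange K K' x) = AdeleRing.baseChange K L x := by
  refine Prod.ext (funext fun W => ?_) (FiniteAdeleRing.ext L fun W => ?_)
  · rw [AdeleRing.baseChange_fst, AdeleRing.baseChange_fst, AdeleRing.baseChange_fst,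
      InfiniteAdeleRing.baseChange_apply, InfiniteAdeleRing.baseChange_apply,
      InfiniteAdeleRing.baseChange_apply]
    have hv : W.comap (algebraMap K L) = (W.comap (algebraMap K' L)).comap (algebraMap K K') :=
      (InfinitePlace.comap_comap_tower K K' L W).symm
    haveI i : W.1.LiesOver ((W.comap (algebraMap K' L)).comap (algebraMap K K')).1 :=
      ⟨congrArg Subtype.val hv⟩
    rw [infiniteCompletionOfComap_eq K W (i := i) hv x.1]
    exact congrFun (infiniteCompletionOfComap_comp_tower (K := K) (K' := K') (L := L) W) _
  · rw [AdeleRing.baseChange_snd, AdeleRing.baseChange_snd, AdeleRing.baseChange_snd,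
      FiniteAdeleRing.baseChange_apply, FiniteAdeleRing.baseChange_apply, FiniteAdeleRing.baseChange_apply]
    have hv : W.under (𝓞 K) = (W.under (𝓞 K')).under (𝓞 K) := (HeightOneSpectrum.under_under K K' L W).symm
    haveI i : W.asIdeal.LiesOver ((W.under (𝓞 K')).under (𝓞 K)).asIdeal :=
      ⟨(congrArg HeightOneSpectrum.asIdeal hv).symm⟩
    rw [adicCompletionOfUnder_eq K W (i := i) hv x.2]
    exact congrFun (adicCompletionOfUnder_comp_tower (K := K) (K' := K') (L := L) W) _

variable (K K' L) in
/-- Idelic form of the transitivity of base change. [folklore] -/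
theorem AdeleRing.ideleBaseChange_ideleBaseChange (x : (AdeleRing (𝓞 K) K)ˣ) :
    AdeleRing.ideleBaseChange K' L (AdeleRing.ideleBaseChange K K' x) = AdeleRing.ideleBaseChange K L x :=
  Units.ext (AdeleRing.baseChange_baseChange K K' L (x : AdeleRing (𝓞 K) K))

/-! ### Transitivity of the idelic norm -/

section Norm

variable [IsGalois K K'] [IsGalois K L] [IsGalois K' L]

omit [NumberField K] [NumberField K'] [NumberField L] [IsGalois K L] [IsGalois K' L] in
/-- A `K`-automorphism of `L` trivial on `K'` is (the restriction of scalars of) a `K'`-automorphism.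
[folklore] -/
theorem exists_restrictScalars_eq_of_restrictNormal_eq_one {θ : L ≃ₐ[K] L}
    (hθ : θ.restrictNormal K' = 1) : ∃ a : L ≃ₐ[K'] L, a.restrictScalars K = θ := by
  refine ⟨{ θ with commutes' := fun c => ?_ }, AlgEquiv.ext fun _ => rfl⟩
  change θ (algebraMap K' L c) = algebraMap K' L c
  rw [← AlgEquiv.restrictNormal_commutes (χ := θ) (E := K'), hθ, AlgEquiv.one_apply]

omit [NumberField K] [NumberField K'] [NumberField L] [IsGalois K L] [IsGalois K' L] in
/-- **Coset decomposition `G(L|K) = ⨆_σ τ_σ G(L|K')`** as a bijection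
`G(K'|K) × G(L|K') ≃ G(L|K)`, `(σ, a) ↦ τ_σ a` for a chosen family of lifts `τ_σ|_{K'} = σ`.
[folklore] -/
theorem bijective_sectionMul {t : (K' ≃ₐ[K] K') → (L ≃ₐ[K] L)}
    (ht : ∀ σ, (t σ).restrictNormal K' = σ) :
    Function.Bijective fun p : (K' ≃ₐ[K] K') × (L ≃ₐ[K'] L) => t p.1 * p.2.restrictScalars K := by
  -- restriction to `K'` as a group homomorphism `r`
  set r : (L ≃ₐ[K] L) →* (K' ≃ₐ[K] K') := AlgEquiv.restrictNormalHom K' with hr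
  have hr_apply : ∀ τ : L ≃ₐ[K] L, r τ = τ.restrictNormal K' := fun τ => rfl
  have hres : ∀ a : L ≃ₐ[K'] L, r (a.restrictScalars K) = 1 := fun a => by
    rw [hr_apply]
    refine AlgEquiv.ext fun c => (algebraMap K' L).injective ?_
    rw [AlgEquiv.restrictNormal_commutes, AlgEquiv.one_apply]
    exact a.commutes c
  have ht' : ∀ σ, r (t σ) = σ := fun σ => by rw [hr_apply, ht]
  have hfst : ∀ (σ : K' ≃ₐ[K] K') (a : L ≃ₐ[K'] L), r (t σ * a.restrictScalars K) = σ := fun σ a => by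
    rw [map_mul, ht', hres, mul_one]
  constructor
  · rintro ⟨σ, a⟩ ⟨σ', b⟩ h
    have h' : t σ * a.restrictScalars K = t σ' * b.restrictScalars K := h
    have hσ : σ = σ' := by rw [← hfst σ a, ← hfst σ' b, h']
    subst hσ
    have hab : a = b := AlgEquiv.restrictScalars_injective K (mul_left_cancel h')
    rw [hab]
  · intro τ
    have h1 : r ((t (r τ))⁻¹ * τ) = 1 := by rw [map_mul, map_inv, ht', inv_mul_cancel]
    obtain ⟨a, ha⟩ := exists_restrictScalars_eq_of_restrictNormal_eq_one (K := K) (K' := K') (L := L)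
      (θ := (t (r τ))⁻¹ * τ) h1
    refine ⟨(r τ, a), ?_⟩
    change t (r τ) * a.restrictScalars K = τ
    rw [ha, mul_inv_cancel_left]

/-- **The Galois norm in a tower**: `∏_{τ ∈ G(L|K)} τ • y = (N_{K'|K}(N_{L|K'} y))_L`, i.e.
`∏_τ τ • y = ∏_σ τ_σ • ∏_{a ∈ G(L|K')} a • y` over coset representatives `τ_σ`.
[cite: CasselsFrohlichANT1967, Ch. II §11] -/
theorem AdeleRing.ideleGalNorm_tower (y : (AdeleRing (𝓞 L) L)ˣ) :
    AdeleRing.ideleGalNorm K L y =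
      AdeleRing.ideleBaseChange K L
        (AdeleRing.ideleRelNorm K K' (AdeleRing.ideleRelNorm K' L y)) := by
  classical
  rw [← AdeleRing.ideleBaseChange_ideleBaseChange K K' L,
    AdeleRing.ideleBaseChange_ideleRelNorm (F := K) (E := K'),
    AdeleRing.ideleGalNorm_apply (F := K) (E := K'), map_prod, AdeleRing.ideleGalNorm_apply (F := K) (E := L)]
  -- coset representatives `t σ` with `t σ|_{K'} = σ`
  choose t ht using fun σ : K' ≃ₐ[K] K' =>
    (show ∃ τ : L ≃ₐ[K] L, τ.restrictNormal K' = σ from AlgEquiv.restrictNormalHom_surjective L σ)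
  let e : (K' ≃ₐ[K] K') × (L ≃ₐ[K'] L) ≃ (L ≃ₐ[K] L) := Equiv.ofBijective _ (bijective_sectionMul ht)
  rw [← Fintype.prod_equiv e (fun p => e p • y) (fun τ => τ • y) (fun _ => rfl), Fintype.prod_prod_type]
  refine Finset.prod_congr rfl fun σ _ => ?_
  change ∏ a : L ≃ₐ[K'] L, (t σ * a.restrictScalars K) • y = _
  simp_rw [mul_smul]
  rw [← Finset.smul_prod', ← ht σ, ← AdeleRing.smul_ideleBaseChange_tower, ht σ,
    AdeleRing.ideleBaseChange_ideleRelNorm, AdeleRing.ideleGalNorm_apply]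
  rfl

variable (K K' L) in
/-- **Transitivity of the idelic norm: `N_{K'|K}(N_{L|K'} y) = N_{L|K} y`** for a tower
`K ⊆ K' ⊆ L` of Galois extensions of number fields.
[cite: CasselsFrohlichANT1967, Ch. II §11 and Ch. VII §2] -/
theorem AdeleRing.ideleRelNorm_ideleRelNorm (y : (AdeleRing (𝓞 L) L)ˣ) :
    AdeleRing.ideleRelNorm K K' (AdeleRing.ideleRelNorm K' L y) = AdeleRing.ideleRelNorm K L y :=
  (AdeleRing.ideleRelNorm_eq_iff.2 (AdeleRing.ideleGalNorm_tower (K := K) (K' := K') y).symm).symm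

end Norm

end Literature.NumberTheory.Automorphic

end
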